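/-
Copyright: lit-balaban Phase-2 proof seat p08 (gen 9).  Statement-level skeleton of a published paper; no proof claims beyond what
the kernel checks below.
-/
import Literature.MathematicalPhysics.QuantumFieldTheory.BalabanImbrieJaffe1984to88.BIJ88CurlyDkLocTorus

/-!
# `BalabanImbrieJaffe1984to88.BIJ88CurlyDkLocDecayTorus` — T. Bałaban, J. Imbrie, A. Jaffe, *Effective action and cluster properties of
the abelian Higgs model*, Commun. Math. Phys. **114** (1988) 257–315 [BalabanImbrieJaffe1988], Sect. 2 p. 261 [PDF 5]: **THE EXPONENTIAL
DECAY (2.13) OF THE LOCALIZED PROPAGATOR `𝒟_{k,loc}` (2.12), KERNEL FORM, FOR THE CONCRETE TORUS OBJECT OF RECORD** (r18's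
`BIJ88CurlyDkLocTorus.dkLocKer` at the printed weights `(η_k^d, L^k)`), constants uniform in `k` and in the radius schedule, **GIVEN ONLY
[6I] PROPOSITION 1.2 BY ITS TREE NAME** (`B5.Prop12Printed`) — file 1 of 2 of seat p08 gen 9 (file 2 = `BIJ88OpDecay213DkLocTorus`: the
printed operator form of (2.13) for all `b`).

statement-level skeleton of published theorems with citation tags; proofs where landed; nothing here is a claim about the Yang–Mills mass gap

PDF held: `paper:balaban1988-cmp114-bij-abelian-higgs-effective-action` (journal page = PDF page + 256), p. 261 [PDF 5] (text layer
`~/.lit/texts/paper-balaban1988-cmp114-bij-abelian-higgs-effective-action/p0005.txt` re-read this session); [I] = [BalabanImbrieJaffe1985]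
p. 312 [PDF 14] (4.4.4), p. 325–326 [PDF 27–28] (7.2.2)–(7.2.4); [6I] = [Balaban1984PropagatorsI] Prop. 1.2 (tree name
`Balaban1983to89.B5.Prop12Printed`).

CITATION HEADER (lean-in-tree rule).  Part of the lit-balaban TYPED SKELETON (HOME `run/shared/lean/pub/lit-balaban/`), Phase-2 proof
seat p08 (gen 9), unit `lit-balaban-p08`; free-target protocol G.5-34(d), TAKING line HOME/STATUS.md 2026-08-21T21:04:47Z.  WHAT IS
REPRODUCED = SKELETON row **C2.Eq2.13** (owner r18, referee ref-5; head `proved` by the abstract hence-steps `BIJ88MultiscaleDecay223`),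
FIRST CLAUSE, kind «model instance»: the decay of `𝒟_{k,loc}` PROVED for the concrete (2.12) of record `dkLocKer` (r18 gen 10, p304403,
rows C2.Eq2.4/2.8/2.9/2.12; offered to this seat in `HOME/lit-balaban-p08/INBOX.md` 2026-08-21T20:59:57Z).  Decls used BY NAME (nothing
restated): r18's `dkLocKer`/`termKer`/`hlKer`/`hKer`/`clKer`/`kdist`, `abs_hlKer_le`, `clKer_ambient_eq_apply`, `dkLocKer_eq_sum`; p09 g8's
`BIJ88ClocEstimatesTorus.cloc_decay` (the p. 261 sentence «estimates analogous to (2.5)–(2.7) for C^{(k)}_{loc}», HYPOTHESIS-FREE, constants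
from `(d, L)`); p08 g7's `BIJ88Ineq217Ineq722Torus.ofLp_HkE_single`/`exists_bound_of_ineq722`, `BIJ88Decay216Torus.triple_sum_le`; p09's
`BIJ85Ineq722DeltaA.ineq722_deltaA_of_prop12Printed`, `torusRep`/`distEU`/`levStd`; r15's typed `BIJ85Sect7Statements.KernelData.Ineq722`.
The sibling for the UNLOCALIZED `𝒟_k` is p08 g8's `BIJ85CurlyDkDecayTorus` (p300921), whose architecture this file repeats with every
factor localized.

THE PRINTED TEXT (p. 261 [PDF 5], verbatim): *"From C^{(k)}_{loc} and H_{k,loc} we construct a localized η-lattice gauge field propagator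
analogous to 𝒟_k: 𝒟_{k,loc} = Σ_{j=0}^{k−1} H^{L^jη}_{j,loc}C^{(j),L^jη}_{loc}H^{*L^jη}_{j,loc} ≡ Σ_{j=0}^{k−1} G^{(j),η}_{loc}. (2.12) Superscripts
L^jη, η, etc. indicate the lattice spacing for operators rescaled to nonstandard lattices. This propagator derives its regularity and decay
from that of C^{(j)}_{loc} and H_{k,loc}. Thus |(𝒟_{k,loc}f)(b)| ≦ ce^{−c dist(suppt f, b)}‖f‖_∞ (2.13) and similarly for derivatives of
𝒟_{k,loc} and Hölder derivatives of order less than 2."*  The mechanism is the print's own sentence *"derives its regularity and decay from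
that of C^{(j)}_{loc} and H_{k,loc}"*: per scale, (2.5) `|H_{j,loc}| ≤ |H_j| ≤ Me^{−δ dist}` (the sup member of [I] (7.2.2)) and the
(2.5)-analogue for `C^{(j)}_{loc}` (p09's `cloc_decay`), rescaled to the `L^jη`-lattice of step `k` (factor `(L^{k−j})^{d−2}`, p. 261
*"operators rescaled to nonstandard lattices"*, r18's `clKer_ambient_eq_apply`); then the sum over `j` is controlled away from the
diagonal exactly as for `𝒟_k` ([I] p. 326; p08 g8).

THE TORUS DATA (all in the tree): tori `Balaban1983to89.Setup`/`Params` (`d ≥ 2`, block size `L`, standing range `k ≤ m + K`, `η_k = L^{−k}`);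
`η`-bonds `PBond P 0`; the kernel of record `dkLocKer w c ρ k b b″ = Σ_{j<k}Σ_{b₁,b₂∈T^{(j)}} H_{j,loc}(b,b₁)C^{(j)}_{loc}(b₁,b₂)H_{j,loc}(b″,b₂)`
(r18, (2.12)) with the cutoffs (2.1)/(2.4) of radii `(ρ_j/16, ρ_j/8)` and the truncation (2.8) of radius `ρ_j/4`, `ρ` ANY radius schedule; the
distance `dist_k(b,b″) = |b₋ − b″₋|_∞/L^k` (`kdist`, units of `T₁^{(k)}`); p09's scale-`j` Landau kernels `(torusRep P j (deltaAData …)).H` and the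
(7.2.2) distance `distEU P j`; p09 g8's `Cloc P j R` ((2.9) of record at native weights).

WHAT IS PROVED (0 `sorry`, standard axioms; theorems only — proof lane; every `d ≥ 2`):
* §1 **`abs_triple_le`** — the generic per-scale estimate behind *"derives its … decay from that of C^{(j)}_{loc} and H_{k,loc}"*: for ANY
  kernels `h : T_η × T^{(j)} → ℝ`, `C : T^{(j)} × T^{(j)} → ℝ` with `|h(b,b₁)| ≤ Me^{−δ dist(b,b₁)}` ((7.2.2) shape) and `|C(b₁,b₂)| ≤ M_Ce^{−δ_C|b₁₋−b₂₋|}`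
  ((7.2.3) shape), `|Σ_{b₁b₂} h(b,b₁)C(b₁,b₂)h(b″,b₂)| ≤ M²M_C·d²e^{a/2}K(a)²·e^{−a|b₋−b″₋|_∞/L^j}`, `a = min(δ,δ_C)/2`, `K(a) = (2(1 + d/a))^d` (p08
  g8's `abs_termDk_le` made kernel-generic; gen 7's `triple_sum_le`).
* §2 **`abs_termLoc_le`**: the scale-`j` term `G^{(j),η}_{loc}(b,b″)` of (2.12) at the weights of step `k` is at most
  `M²·M_C(L^{k−j})^{d−2}·d²e^{a/2}K(a)²·e^{−a|b₋−b″₋|_∞/L^j}` given the sup member of (7.2.2) for `H_j` and a (2.5)-analogue bound for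
  `C^{(j)}_{loc}` of record at every radius (`|H_{j,loc}| ≤ |H_j|`, r18's `abs_hlKer_le`; `C^{(j),L^jη}_{loc} = (L^{k−j})^{d−2}C^{(j)}_{loc}`, r18's
  `clKer_ambient_eq_apply`) — uniformly in the radius schedule `ρ`.
* §3 **`abs_sum_scales_le`** (the multiscale step, real analysis only: `Σ_{j<k} Aℓ_j^{q}e^{−aℓ_jD} ≤ A(q+1)!/a^{q+1}·e^{−(a/2)D}` for `D ≥ 2`,
  `ℓ_j = L^{k−j}`, via `ℓ^qe^{−aℓ} ≤ (q+1)!/(a^{q+1}ℓ)` and `Σ_{j<k}ℓ_j⁻¹ ≤ 1`) and **`abs_dkLocKer_le`**: for `D = dist_k(b,b″) ≥ 2`,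
  `|𝒟_{k,loc}(b,b″)| ≤ M²M_C·d²e^{a/2}K(a)²·(d−1)!/a^{d−1}·e^{−(a/2)D}`, uniform in `k ≤ m + K` AND in `ρ`.
* §4 **`decayDkLoc_torus_of_ineq722`** (from r15's typed (7.2.2) for p09's kernel family; the `C^{(j)}_{loc}` input DISCHARGED by p09 g8's
  hypothesis-free `cloc_decay`) and **`decayDkLoc_torus_prop12`**: `∃ R₀ c₀ δ′, 0 < δ′ ∧ 0 ≤ c₀ ∧ ∀ k ≤ m + K, ∀ ρ, ∀ b b″, R₀ ≤ dist_k(b,b″) →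
  |𝒟_{k,loc}(b,b″)| ≤ c₀e^{−δ′dist_k(b,b″)}` GIVEN ONLY `B5.Prop12Printed`.
* §5 **«singularities on the diagonal» as an UPPER bound**: `abs_termLoc_le_unif` / **`abs_dkLocKer_le_diag`** — for ALL `b, b″`,
  `|𝒟_{k,loc}(b,b″)| ≤ M²M_C·d²e^{a/2}K(a)²·Σ_{j<k}(L^{k−j})^{d−2}`, and `sum_pow_scales_le`: `Σ_{j<k}(L^{k−j})^{d−2} ≤ 2(L^k)^{d−2} = 2η^{−(d−2)}` for
  `d ≥ 3` (at `d = 2` the sum is `k = log_L η⁻¹`) — the size of [I] p. 326's *"singularities on the diagonal"* for the localized propagator.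
HONEST SCOPE.  (i) This file proves the KERNEL decay of (2.13) beyond a threshold (`dist_k ≥ R₀`, as [I] p. 326 states it for `𝒟_k`) and the
diagonal upper bound; the printed OPERATOR form `|(𝒟_{k,loc}f)(b)| ≤ ce^{−c dist(suppt f,b)}‖f‖_∞` for ALL `b` (the `η^d`-weighted action, in
which the diagonal singularity is integrable) is file 2; the derivative/Hölder clauses are not proved here (inputs: p08 g8's
`BIJ85CurlyDk{Grad,Holder}Torus` pattern).  (ii) The remaining hypothesis is [6I] Proposition 1.2 BY NAME for p09's torus settings (the `h12` of
rows C1.Eq7.2.1-7.2.2 / C2.Eq2.16); its constants, hence `(R₀, c₀, δ′)`, are existential PER TORUS `P` (cf. GAPS G-C1-07, p16), uniform in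
`k ≤ m + K` and in `ρ`; the `C^{(j)}_{loc}` constants depend on `(d, L)` only (p09).  (iii) `ℓ^∞` distances in the unit `L^kη = 1`; threshold `2`,
constants explicit, not optimal; `U = 1`, real abelian fields, torus, standing range (`k ≤ m + K`, so every `j < k` has `j + 1 ≤ m + K`, the
range of `cloc_decay`).  (iv) No smallness of `e_k` and no property of the cutoff beyond `0 ≤ ζ ≤ 1` is used (the decay does not need the
localization; the finite range is r18's `vanishes_dkLocKer`).  (v) No `def`, no new named fact, nothing restated; NOT summit progress.  Unit
`lit-balaban-p08` (literature-prover-lit-balaban-p08-g9-0), 2026-08-21.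
-/

open scoped BigOperators RealInnerProductSpace

namespace Literature.MathematicalPhysics.QuantumFieldTheory.BalabanImbrieJaffe1984to88.BIJ88CurlyDkLocDecayTorus

open Balaban1983to89 hiding Site Plaq
open Balaban1983to89.LatticeFieldCalculus
open BIJ88Ineq217Ineq722Torus (ofLp_HkE_single exists_bound_of_ineq722 torusKernelData_gradH_nonneg)
open BIJ88Decay216Torus (triple_sum_le)
open BIJ85Prop521Torus BIJ85Prop522Torus BIJ85Sigma422Eta
open BIJ85Sect7Statements BIJ85Ineq722Torus
open BIJ85Ineq722DeltaA (deltaAData ineq722_deltaA_of_prop12Printed)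
open BIJ85Ineq722ProofPart2 (settingOf)
open BIJ88ClocFactorsTorus (distB distB_apply)
open BIJ88ClocEstimatesTorus (Cloc cloc_decay)
open BIJ88CurlyDkLocTorus
-- inside this namespace the bare `Site`/`Plaq` are the `ℤ^d` carriers of the QFT root; the torus ones are renamed:
open Balaban1983to89 renaming Site → TSite, Plaq → TPlaq

noncomputable section

variable {P : Params}

/-! ## §1  The generic per-scale estimate: «derives its regularity and decay from that of C^{(j)}_{loc} and H_{k,loc}» -/

/-- `Σ_b f(b₋) = d·Σ_y f(y)` on `T^{(j)}`. [folklore] -/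
private theorem sum_bond_src {j : ℕ} (f : TSite P j → ℝ) : ∑ b : PBond P j, f b.src = (P.d : ℝ) * ∑ y : TSite P j, f y := by
  rw [← Fintype.sum_equiv (LatticeFieldCalculus.bondEquiv (P := P) (j := j)) (fun q : TSite P j × Fin P.d => f q.1) _
    (fun q => rfl), Fintype.sum_prod_type]
  simp only [Finset.sum_const, Finset.card_univ, Fintype.card_fin, nsmul_eq_mul]
  rw [Finset.mul_sum]

/-- `0 < L^n`. [folklore] -/
private theorem cast_pow_L_pos' (n : ℕ) : (0 : ℝ) < (P.L : ℝ) ^ n := pow_pos P.cast_L_pos n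

/-- **THE PER-SCALE ESTIMATE, KERNEL-GENERIC** (`j ≤ m + K`): for kernels `h(b, b₁)` (`b` an `η`-bond, `b₁ ∈ T^{(j)}`) and `C(b₁, b₂)` on
`T^{(j)}` with `|h(b, b₁)| ≤ Me^{−δ dist(b,b₁)}` (the (7.2.2) distance `distEU P j`) and `|C(b₁, b₂)| ≤ M_Ce^{−δ_C|b₁₋ − b₂₋|_∞}`, the composite
`Σ_{b₁,b₂} h(b, b₁)C(b₁, b₂)h(b″, b₂)` is at most `M²M_C·d²e^{a/2}K(a)²·e^{−a|b₋ − b″₋|_∞/L^j}`, `a = min(δ, δ_C)/2`, `K(a) = (2(1 + d/a))^d` — *"This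
propagator derives its regularity and decay from that of C^{(j)}_{loc} and H_{k,loc}"* (gen 7's `triple_sum_le`).
[cite: BalabanImbrieJaffe1988, (2.12) p.261] -/
theorem abs_triple_le {j : ℕ} (hj : j ≤ P.m + P.K) {δ M δC MC : ℝ} (hδ : 0 < δ) (hδC : 0 < δC) (hM : 0 ≤ M) (hMC : 0 ≤ MC)
    {h : PBond P 0 → PBond P j → ℝ} {C : PBond P j → PBond P j → ℝ}
    (hH : ∀ (b₀ : PBond P 0) (b₁ : PBond P j), |h b₀ b₁| ≤ M * Real.exp (-(δ * distEU P j b₀.src b₁.src)))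
    (hC : ∀ b₁ b₂ : PBond P j, |C b₁ b₂| ≤ MC * Real.exp (-(δC * (supDist b₁.src b₂.src : ℝ))))
    (b b'' : PBond P 0) :
    |∑ b₁ : PBond P j, ∑ b₂ : PBond P j, h b b₁ * C b₁ b₂ * h b'' b₂| ≤
      M ^ 2 * MC * (P.d : ℝ) ^ 2 * (Real.exp (min δ δC / 2 / 2) * ((2 * (1 + P.d / (min δ δC / 2))) ^ P.d) ^ 2) *
        Real.exp (-(min δ δC / 2 * ((supDist b.src b''.src : ℝ) / (P.L : ℝ) ^ j))) := by
  -- termwise bound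
  have hpt : ∀ b₁ b₂ : PBond P j, |h b b₁ * C b₁ b₂ * h b'' b₂| ≤
      M ^ 2 * MC * (Real.exp (-(δ * distEU P j b.src b₁.src)) * Real.exp (-(δC * (supDist b₁.src b₂.src : ℝ))) *
        Real.exp (-(δ * distEU P j b''.src b₂.src))) := by
    intro b₁ b₂
    rw [abs_mul, abs_mul]
    have h1 := hH b b₁
    have h2 := hH b'' b₂
    have h3 := hC b₁ b₂
    calc _ ≤ (M * Real.exp (-(δ * distEU P j b.src b₁.src))) * (MC * Real.exp (-(δC * (supDist b₁.src b₂.src : ℝ)))) *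
          (M * Real.exp (-(δ * distEU P j b''.src b₂.src))) :=
          mul_le_mul (mul_le_mul h1 h3 (abs_nonneg _) (by positivity)) h2 (abs_nonneg _) (by positivity)
      _ = _ := by ring
  calc _ ≤ ∑ b₁ : PBond P j, ∑ b₂ : PBond P j, M ^ 2 * MC * (Real.exp (-(δ * distEU P j b.src b₁.src)) *
          Real.exp (-(δC * (supDist b₁.src b₂.src : ℝ))) * Real.exp (-(δ * distEU P j b''.src b₂.src))) :=
        (Finset.abs_sum_le_sum_abs _ _).trans (Finset.sum_le_sum fun b₁ _ =>
          (Finset.abs_sum_le_sum_abs _ _).trans (Finset.sum_le_sum fun b₂ _ => hpt b₁ b₂))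
    _ = M ^ 2 * MC * ((P.d : ℝ) * ∑ y : TSite P j, (P.d : ℝ) * ∑ y' : TSite P j, Real.exp (-(δ * distEU P j b.src y)) *
          Real.exp (-(δC * (supDist y y' : ℝ))) * Real.exp (-(δ * distEU P j b''.src y'))) := by
        rw [← sum_bond_src (fun y => (P.d : ℝ) * ∑ y' : TSite P j, Real.exp (-(δ * distEU P j b.src y)) *
          Real.exp (-(δC * (supDist y y' : ℝ))) * Real.exp (-(δ * distEU P j b''.src y'))), Finset.mul_sum]
        refine Finset.sum_congr rfl fun b₁ _ => ?_
        rw [← sum_bond_src (fun y' => Real.exp (-(δ * distEU P j b.src b₁.src)) * Real.exp (-(δC * (supDist b₁.src y' : ℝ))) *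
          Real.exp (-(δ * distEU P j b''.src y'))), Finset.mul_sum]
    _ = M ^ 2 * MC * (P.d : ℝ) ^ 2 * ∑ y : TSite P j, ∑ y' : TSite P j, Real.exp (-(δ * distEU P j b.src y)) *
          Real.exp (-(δC * (supDist y y' : ℝ))) * Real.exp (-(δ * distEU P j b''.src y')) := by
        rw [← Finset.mul_sum]; ring
    _ ≤ M ^ 2 * MC * (P.d : ℝ) ^ 2 * (Real.exp (min δ δC / 2 / 2) * ((2 * (1 + P.d / (min δ δC / 2))) ^ P.d) ^ 2 *
          Real.exp (-(min δ δC / 2 * ((supDist b.src b''.src : ℝ) / (P.L : ℝ) ^ j)))) :=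
        mul_le_mul_of_nonneg_left (triple_sum_le hj hδ hδC b.src b''.src) (by positivity)
    _ = _ := by ring

/-! ## §2  The scale-`j` term of (2.12) for the object of record -/

/-- **(2.5) for `H_{j,loc}` from the sup member of (7.2.2)**: `|H_{j,loc}(b, b₁)| ≤ |H_j(b, b₁)| ≤ Me^{−δ dist(b,b₁)}` at any weights `w > 0`,
`c ≠ 0` and any radii (r18's `abs_hlKer_le`; the kernel of record `hKer` IS p09's `(torusRep P j …).H`, gen 7's `ofLp_HkE_single`).
[cite: BalabanImbrieJaffe1988, (2.5) p.260] -/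
theorem abs_hlKer_le_of_sup {j : ℕ} (hj : j ≤ P.m + P.K) {w c : ℝ} (hw : 0 < w) (hc : c ≠ 0) {a : ℝ} (ha : 0 < a) {δ M : ℝ}
    (hH : ∀ (μ ν : Fin P.d) (x : TSite P 0) (y : TSite P j),
      |(torusRep P j (deltaAData hj a)).H (x, μ) (y, ν)| ≤ M * Real.exp (-(δ * distEU P j x y)))
    (R₁ R₀ : ℝ) (b₀ : PBond P 0) (b₁ : PBond P j) :
    |hlKer (P := P) w c R₁ R₀ j b₀ b₁| ≤ M * Real.exp (-(δ * distEU P j b₀.src b₁.src)) := by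
  refine (abs_hlKer_le w c R₁ R₀ j b₀ b₁).trans ?_
  have e : hKer (P := P) w c j b₀ b₁ = (torusRep P j (deltaAData hj a)).H (b₀.src, b₀.dir) (b₁.src, b₁.dir) :=
    ofLp_HkE_single hj hc hw ha b₁ b₀.src b₀.dir
  rw [e]
  exact hH _ _ _ _

/-- **the rescaled (2.5)-analogue for `C^{(j),L^jη}_{loc}`**: at the weights `(η_k^d, L^k)` of step `k ≥ j`, a bound `|C^{(j)}_{loc}(b₁,b₂)| ≤
M_Ce^{−δ_C|b₁₋−b₂₋|_∞}` for the (2.9) of record `Cloc P j R` gives `|C^{(j),L^jη}_{loc}(b₁,b₂)| ≤ M_C(L^{k−j})^{d−2}e^{−δ_C|b₁₋−b₂₋|_∞}` — p. 261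
*"operators rescaled to nonstandard lattices"* (r18's `clKer_ambient_eq_apply`). [cite: BalabanImbrieJaffe1988, (2.12) p.261] -/
theorem abs_clKer_ambient_le (hd : 2 ≤ P.d) {j k : ℕ} (hjk : j ≤ k) {δC MC : ℝ} {R : ℝ}
    (hCl : ∀ b₁ b₂ : PBond P j, |Cloc P j R b₁ b₂| ≤ MC * Real.exp (-(δC * (supDist b₁.src b₂.src : ℝ))))
    (b₁ b₂ : PBond P j) :
    |clKer (P := P) ((P.eta k) ^ P.d) ((P.L : ℝ) ^ k) R j b₁ b₂| ≤
      MC * ((P.L : ℝ) ^ (k - j)) ^ (P.d - 2) * Real.exp (-(δC * (supDist b₁.src b₂.src : ℝ))) := by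
  have hℓ : 0 < ((P.L : ℝ) ^ (k - j)) ^ (P.d - 2) := pow_pos (cast_pow_L_pos' _) _
  rw [clKer_ambient_eq_apply hd hjk, abs_mul, abs_of_pos hℓ]
  calc ((P.L : ℝ) ^ (k - j)) ^ (P.d - 2) * |Cloc P j R b₁ b₂|
      ≤ ((P.L : ℝ) ^ (k - j)) ^ (P.d - 2) * (MC * Real.exp (-(δC * (supDist b₁.src b₂.src : ℝ)))) :=
        mul_le_mul_of_nonneg_left (hCl b₁ b₂) hℓ.le
    _ = _ := by ring

/-- **THE SCALE-`j` TERM `G^{(j),η}_{loc}(b, b″)` OF (2.12) AT THE WEIGHTS OF STEP `k`** (`j ≤ k`, `j ≤ m + K`, every `d ≥ 2`, ANY radius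
schedule `ρ`): given the sup member of (7.2.2) for the scale-`j` Landau kernel and a (2.5)-analogue bound for the `C^{(j)}_{loc}` of record at
the radius `ρ_j/4`, `|G^{(j),η}_{loc}(b, b″)| ≤ M²·M_C(L^{k−j})^{d−2}·d²e^{a/2}K(a)²·e^{−a|b₋−b″₋|_∞/L^j}`, `a = min(δ, δ_C)/2` — §1 with `h = H_{j,loc}`,
`C = C^{(j),L^jη}_{loc}`. [cite: BalabanImbrieJaffe1988, (2.12) p.261] -/
theorem abs_termLoc_le (hd : 2 ≤ P.d) {k j : ℕ} (hj : j ≤ P.m + P.K) (hjk : j ≤ k) {a : ℝ} (ha : 0 < a)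
    {δ M δC MC : ℝ} (hδ : 0 < δ) (hδC : 0 < δC) (hMC : 0 ≤ MC)
    (hH : ∀ (μ ν : Fin P.d) (x : TSite P 0) (y : TSite P j),
      |(torusRep P j (deltaAData hj a)).H (x, μ) (y, ν)| ≤ M * Real.exp (-(δ * distEU P j x y)))
    (ρ : ℕ → ℝ)
    (hCl : ∀ b₁ b₂ : PBond P j, |Cloc P j (ρ j / 4) b₁ b₂| ≤ MC * Real.exp (-(δC * (supDist b₁.src b₂.src : ℝ))))
    (b b'' : PBond P 0) :
    |termKer (P := P) ((P.eta k) ^ P.d) ((P.L : ℝ) ^ k) ρ j b b''| ≤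
      M ^ 2 * (MC * ((P.L : ℝ) ^ (k - j)) ^ (P.d - 2)) * (P.d : ℝ) ^ 2 *
        (Real.exp (min δ δC / 2 / 2) * ((2 * (1 + P.d / (min δ δC / 2))) ^ P.d) ^ 2) *
        Real.exp (-(min δ δC / 2 * ((supDist b.src b''.src : ℝ) / (P.L : ℝ) ^ j))) := by
  have hw : 0 < (P.eta k) ^ P.d := pow_pos (eta_pos P k) _
  have hc : (P.L : ℝ) ^ k ≠ 0 := (cast_pow_L_pos' k).ne'
  have hM : 0 ≤ M := by
    have h := hH ⟨0, P.hd⟩ ⟨0, P.hd⟩ default default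
    exact (mul_nonneg_iff_of_pos_right (Real.exp_pos _)).1 ((abs_nonneg _).trans h)
  have hMC' : 0 ≤ MC * ((P.L : ℝ) ^ (k - j)) ^ (P.d - 2) := mul_nonneg hMC (pow_pos (cast_pow_L_pos' _) _).le
  unfold termKer
  exact abs_triple_le hj hδ hδC hM hMC' (abs_hlKer_le_of_sup hj hw hc ha hH (ρ j / 16) (ρ j / 8))
    (abs_clKer_ambient_le hd hjk hCl) b b''

/-! ## §3  The multiscale sum: exponential decay of `𝒟_{k,loc}(b, b″)` away from the diagonal -/

/-- `x^q·e^{−ax} ≤ (q+1)!/(a^{q+1}x)` (`a, x > 0`). [folklore] -/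
private theorem pow_mul_exp_neg_le {a x : ℝ} (ha : 0 < a) (hx : 0 < x) (q : ℕ) :
    x ^ q * Real.exp (-(a * x)) ≤ ((q + 1).factorial : ℝ) / (a ^ (q + 1) * x) := by
  have h := Real.pow_div_factorial_le_exp (a * x) (by positivity) (q + 1)
  rw [div_le_iff₀ (by positivity)] at h
  rw [le_div_iff₀ (by positivity)]
  calc x ^ q * Real.exp (-(a * x)) * (a ^ (q + 1) * x) = (a * x) ^ (q + 1) * Real.exp (-(a * x)) := by ring
    _ ≤ Real.exp (a * x) * ((q + 1).factorial : ℝ) * Real.exp (-(a * x)) := mul_le_mul_of_nonneg_right h (Real.exp_pos _).le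
    _ = ((q + 1).factorial : ℝ) := by
        rw [mul_comm (Real.exp _), mul_assoc, ← Real.exp_add, add_neg_cancel, Real.exp_zero, mul_one]

/-- `Σ_{j<k} L^{−(k−j)} ≤ 1` (`L ≥ 2`; induction: `S_{k+1} = L⁻¹(S_k + 1)`). [folklore] -/
private theorem sum_inv_pow_le_one (k : ℕ) : ∑ j ∈ Finset.range k, ((P.L : ℝ) ^ (k - j))⁻¹ ≤ 1 := by
  have hL : (2 : ℝ) ≤ P.L := by exact_mod_cast P.hL.2
  induction k with
  | zero => simp
  | succ k ih =>
    have e : ∑ j ∈ Finset.range (k + 1), ((P.L : ℝ) ^ (k + 1 - j))⁻¹ =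
        (P.L : ℝ)⁻¹ * (∑ j ∈ Finset.range k, ((P.L : ℝ) ^ (k - j))⁻¹ + 1) := by
      rw [Finset.sum_range_succ, show k + 1 - k = 1 by omega, pow_one, mul_add, mul_one, Finset.mul_sum]
      refine congrArg (· + _) (Finset.sum_congr rfl fun j hj => ?_)
      rw [show k + 1 - j = (k - j) + 1 by have := Finset.mem_range.1 hj; omega, pow_succ, mul_inv, mul_comm]
    rw [e]
    calc (P.L : ℝ)⁻¹ * (∑ j ∈ Finset.range k, ((P.L : ℝ) ^ (k - j))⁻¹ + 1) ≤ 2⁻¹ * (1 + 1) :=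
          mul_le_mul ((inv_le_inv₀ (by linarith) two_pos).2 hL) (by linarith) (by positivity) (by norm_num)
      _ = 1 := by norm_num

/-- `L^k = L^j·L^{k−j}` for `j ≤ k`. [folklore] -/
private theorem pow_eq_pow_mul_pow' {j k : ℕ} (hjk : j ≤ k) : (P.L : ℝ) ^ k = (P.L : ℝ) ^ j * (P.L : ℝ) ^ (k - j) := by
  rw [← pow_add, Nat.add_sub_cancel' hjk]

/-- **THE MULTISCALE STEP** (real analysis only; [I] p. 326 / C2 p. 262 *"the rapid decay of terms with small j controls the scalings and
the sum over j"*): if the scale-`j` terms obey `|T_j| ≤ A·ℓ_j^q·e^{−aℓ_jD}` with `ℓ_j = L^{k−j}` (`j < k`) and `D ≥ 2`, then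
`|Σ_{j<k}T_j| ≤ A·(q+1)!/a^{q+1}·e^{−(a/2)D}` — uniformly in `k`: `e^{−aℓD} ≤ e^{−aℓ}e^{−(a/2)D}`, `ℓ^qe^{−aℓ} ≤ (q+1)!/(a^{q+1}ℓ)`,
`Σ_{j<k}ℓ_j⁻¹ ≤ 1`. [cite: BalabanImbrieJaffe1988, (2.13) p.261] -/
theorem abs_sum_scales_le {k : ℕ} {T : ℕ → ℝ} {A a D : ℝ} (hA : 0 ≤ A) (ha : 0 < a) (hD : 2 ≤ D) (q : ℕ)
    (hT : ∀ j < k, |T j| ≤ A * ((P.L : ℝ) ^ (k - j)) ^ q * Real.exp (-(a * ((P.L : ℝ) ^ (k - j) * D)))) :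
    |∑ j ∈ Finset.range k, T j| ≤ A * (((q + 1).factorial : ℝ) / a ^ (q + 1)) * Real.exp (-(a / 2 * D)) := by
  have hD1 : 1 ≤ D := by linarith
  have hterm : ∀ j ∈ Finset.range k,
      |T j| ≤ A * ((((q + 1).factorial : ℝ) / (a ^ (q + 1) * (P.L : ℝ) ^ (k - j))) * Real.exp (-(a / 2 * D))) := by
    intro j hjm
    have hjk : j < k := Finset.mem_range.1 hjm
    refine (hT j hjk).trans ?_
    set ℓ : ℝ := (P.L : ℝ) ^ (k - j) with hℓ
    have hℓ1 : 1 ≤ ℓ := one_le_pow₀ (by exact_mod_cast P.L_pos)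
    have hℓ0 : 0 < ℓ := by linarith
    have h2 : Real.exp (-(a * (ℓ * D))) ≤ Real.exp (-(a * ℓ)) * Real.exp (-(a / 2 * D)) := by
      rw [← Real.exp_add]
      refine Real.exp_le_exp.2 ?_
      nlinarith [mul_nonneg (sub_nonneg.2 hℓ1) (sub_nonneg.2 hD1), ha.le, mul_nonneg ha.le (sub_nonneg.2 hD1),
        mul_nonneg ha.le (mul_nonneg (sub_nonneg.2 hℓ1) (sub_nonneg.2 hD1))]
    have h4 : ℓ ^ q * Real.exp (-(a * ℓ)) ≤ ((q + 1).factorial : ℝ) / (a ^ (q + 1) * ℓ) := pow_mul_exp_neg_le ha hℓ0 q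
    rw [mul_assoc]
    refine mul_le_mul_of_nonneg_left ?_ hA
    calc ℓ ^ q * Real.exp (-(a * (ℓ * D)))
        ≤ ℓ ^ q * (Real.exp (-(a * ℓ)) * Real.exp (-(a / 2 * D))) := mul_le_mul_of_nonneg_left h2 (by positivity)
      _ = ℓ ^ q * Real.exp (-(a * ℓ)) * Real.exp (-(a / 2 * D)) := by ring
      _ ≤ ((q + 1).factorial : ℝ) / (a ^ (q + 1) * ℓ) * Real.exp (-(a / 2 * D)) :=
          mul_le_mul_of_nonneg_right h4 (Real.exp_pos _).le
  calc _ ≤ ∑ j ∈ Finset.range k, A * ((((q + 1).factorial : ℝ) / (a ^ (q + 1) * (P.L : ℝ) ^ (k - j))) * Real.exp (-(a / 2 * D))) :=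
        (Finset.abs_sum_le_sum_abs _ _).trans (Finset.sum_le_sum hterm)
    _ = A * (((q + 1).factorial : ℝ) / a ^ (q + 1)) * Real.exp (-(a / 2 * D)) *
          ∑ j ∈ Finset.range k, ((P.L : ℝ) ^ (k - j))⁻¹ := by
        rw [Finset.mul_sum]
        refine Finset.sum_congr rfl fun j _ => ?_
        field_simp
    _ ≤ A * (((q + 1).factorial : ℝ) / a ^ (q + 1)) * Real.exp (-(a / 2 * D)) * 1 :=
        mul_le_mul_of_nonneg_left (sum_inv_pow_le_one k) (by positivity)
    _ = _ := by rw [mul_one]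

/-- **EXPONENTIAL DECAY OF `𝒟_{k,loc}(b, b″)` ON THE TORI, explicit constants, every `d ≥ 2`, EVERY radius schedule `ρ`**: for
`D := dist_k(b, b″) = |b₋ − b″₋|_∞/L^k ≥ 2` and `a = min(δ, δ_C)/2`, `|𝒟_{k,loc}(b, b″)| ≤ M²M_C·d²e^{a/2}K(a)²·(d−1)!/a^{d−1}·e^{−(a/2)D}`, GIVEN the
sup member of (7.2.2) for every `H_j`, `j < k`, and the (2.5)-analogue for the `C^{(j)}_{loc}` of record, `j < k`, at the radii `ρ_j/4`: the
scale-`j` term of §2 is `≲ ℓ^{d−2}e^{−aℓD}` (`ℓ = L^{k−j}`), and the multiscale step sums it — *"This propagator derives its regularity and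
decay from that of C^{(j)}_{loc} and H_{k,loc}. Thus … (2.13)"*. [cite: BalabanImbrieJaffe1988, (2.13) p.261] -/
theorem abs_dkLocKer_le (hd : 2 ≤ P.d) {k : ℕ} (hk : k ≤ P.m + P.K) {a : ℝ} (ha : 0 < a) {δ M δC MC : ℝ} (hδ : 0 < δ)
    (hδC : 0 < δC) (hMC : 0 ≤ MC)
    (hH : ∀ (j : ℕ) (hj : j ≤ P.m + P.K), j < k → ∀ (μ ν : Fin P.d) (x : TSite P 0) (y : TSite P j),
      |(torusRep P j (deltaAData hj a)).H (x, μ) (y, ν)| ≤ M * Real.exp (-(δ * distEU P j x y)))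
    (ρ : ℕ → ℝ)
    (hCl : ∀ j < k, ∀ b₁ b₂ : PBond P j, |Cloc P j (ρ j / 4) b₁ b₂| ≤ MC * Real.exp (-(δC * (supDist b₁.src b₂.src : ℝ))))
    {b b'' : PBond P 0} (hD : 2 ≤ kdist (P := P) k b b'') :
    |dkLocKer (P := P) ((P.eta k) ^ P.d) ((P.L : ℝ) ^ k) ρ k b b''| ≤
      M ^ 2 * MC * ((P.d : ℝ) ^ 2 * (Real.exp (min δ δC / 2 / 2) * ((2 * (1 + P.d / (min δ δC / 2))) ^ P.d) ^ 2)) *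
          (((P.d - 2 + 1).factorial : ℝ) / (min δ δC / 2) ^ (P.d - 2 + 1)) *
        Real.exp (-(min δ δC / 2 / 2 * kdist (P := P) k b b'')) := by
  have ha₀ : 0 < min δ δC / 2 := half_pos (lt_min hδ hδC)
  rw [dkLocKer_eq_sum]
  refine abs_sum_scales_le (P := P) (k := k)
    (T := fun j => termKer (P := P) ((P.eta k) ^ P.d) ((P.L : ℝ) ^ k) ρ j b b'')
    (A := M ^ 2 * MC * ((P.d : ℝ) ^ 2 * (Real.exp (min δ δC / 2 / 2) * ((2 * (1 + P.d / (min δ δC / 2))) ^ P.d) ^ 2)))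
    (a := min δ δC / 2) (D := kdist (P := P) k b b'') (by positivity) ha₀ hD (P.d - 2) fun j hjk => ?_
  have hj : j ≤ P.m + P.K := by omega
  have hLj := cast_pow_L_pos' (P := P) j
  have hLkj := cast_pow_L_pos' (P := P) (k - j)
  have e1 : (supDist b.src b''.src : ℝ) / (P.L : ℝ) ^ j = (P.L : ℝ) ^ (k - j) * kdist (P := P) k b b'' := by
    unfold kdist
    rw [pow_eq_pow_mul_pow' (P := P) hjk.le]
    field_simp
  refine (abs_termLoc_le hd hj hjk.le ha hδ hδC hMC (hH j hj hjk) ρ (hCl j hjk) b b'').trans (le_of_eq ?_)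
  rw [e1]
  ring

/-! ## §4  Assembly: the decay of (2.13) on the tori given only [6I] Proposition 1.2 -/

/-- **`𝒟_{k,loc}` DECAYS EXPONENTIALLY ON THE TORI, FROM THE TYPED (7.2.2) ALONE**, constants UNIFORM IN `k` AND IN THE RADIUS SCHEDULE:
given r15's `KernelData.Ineq722` for p09's kernel family (scales covering the standing range) — the `C^{(j)}_{loc}` input being p09 g8's
HYPOTHESIS-FREE `cloc_decay` — `∃ R₀ c₀ δ′, 0 < δ′ ∧ 0 ≤ c₀ ∧ ∀ k ≤ m + K, ∀ ρ, ∀ b b″, R₀ ≤ dist_k(b,b″) → |𝒟_{k,loc}(b, b″)| ≤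
c₀e^{−δ′dist_k(b,b″)}` for r18's `dkLocKer` at the printed weights `(η_k^d, L^k)`. [cite: BalabanImbrieJaffe1988, (2.13) p.261] -/
theorem decayDkLoc_torus_of_ineq722 (hd : 2 ≤ P.d) {lev : ℕ → ℕ} (hlev : ∀ i, lev i ≤ P.m + P.K)
    (hcov : ∀ j ≤ P.m + P.K, ∃ i, lev i = j) {a : ℝ} {BondU : ℕ → Type}
    {distEB : (i : ℕ) → TSite P 0 → BondU i → ℝ} {Cker : (i : ℕ) → Fin P.d → Fin P.d → TSite P (lev i) → TSite P (lev i) → ℝ}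
    {Dker : (i : ℕ) → TSite P 0 → BondU i → ℝ}
    (h722 : KernelData.Ineq722
      (fun i => torusKernelData P (lev i) (deltaAData (hlev i) a) (BondU i) (distEB i) (Cker i) (Dker i))) (ha : 0 < a) :
    ∃ R₀ c₀ δ' : ℝ, 0 < δ' ∧ 0 ≤ c₀ ∧ ∀ (k : ℕ) (_ : k ≤ P.m + P.K) (ρ : ℕ → ℝ) (b b'' : PBond P 0),
        R₀ ≤ kdist (P := P) k b b'' →
        |dkLocKer (P := P) ((P.eta k) ^ P.d) ((P.L : ℝ) ^ k) ρ k b b''| ≤ c₀ * Real.exp (-δ' * kdist (P := P) k b b'') := by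
  obtain ⟨δ, M, hδ, -, hBall⟩ := exists_bound_of_ineq722 hlev h722
  obtain ⟨MC, δC, hMC, hδC, HC⟩ := cloc_decay P.d P.L hd
  refine ⟨2, M ^ 2 * MC * ((P.d : ℝ) ^ 2 * (Real.exp (min δ δC / 2 / 2) * ((2 * (1 + P.d / (min δ δC / 2))) ^ P.d) ^ 2)) *
      (((P.d - 2 + 1).factorial : ℝ) / (min δ δC / 2) ^ (P.d - 2 + 1)),
    min δ δC / 2 / 2, by positivity, by positivity, fun k hk ρ b b'' hfar => ?_⟩
  have hH : ∀ (j : ℕ) (hj : j ≤ P.m + P.K), j < k → ∀ (μ ν : Fin P.d) (x : TSite P 0) (y : TSite P j),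
      |(torusRep P j (deltaAData hj a)).H (x, μ) (y, ν)| ≤ M * Real.exp (-(δ * distEU P j x y)) := by
    intro j hj _ μ ν x y
    obtain ⟨i, hi⟩ := hcov j hj
    subst hi
    exact (le_add_of_nonneg_right torusKernelData_gradH_nonneg).trans (hBall i μ ν x y)
  have hCl : ∀ j < k, ∀ b₁ b₂ : PBond P j,
      |Cloc P j (ρ j / 4) b₁ b₂| ≤ MC * Real.exp (-(δC * (supDist b₁.src b₂.src : ℝ))) := by
    intro j hjk b₁ b₂
    have h := HC P rfl rfl j inferInstance (by omega) (ρ j / 4) b₁ b₂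
    rwa [distB_apply] at h
  rw [neg_mul]
  exact abs_dkLocKer_le hd hk ha hδ hδC hMC.le hH ρ hCl hfar

/-- **THE DECAY OF (2.13) ON THE TORI GIVEN ONLY [6I] PROPOSITION 1.2 BY ITS TREE NAME** (`B5.Prop12Printed` for p09's family of scales
`levStd` — the `h12` of rows C1.Eq7.2.1-7.2.2 / C2.Eq2.16): for the concrete (2.12) of record at the printed weights,
`∃ R₀ c₀ δ′, 0 < δ′ ∧ 0 ≤ c₀ ∧ ∀ k ≤ m + K, ∀ ρ, ∀ b b″, R₀ ≤ dist_k(b, b″) → |𝒟_{k,loc}(b, b″)| ≤ c₀e^{−δ′dist_k(b, b″)}` — (7.2.2) via p09's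
`ineq722_deltaA_of_prop12Printed`, the `C^{(j)}_{loc}` estimate HYPOTHESIS-FREE by p09 g8's `cloc_decay`. [cite: BalabanImbrieJaffe1988, (2.13) p.261] -/
theorem decayDkLoc_torus_prop12 (hd : 2 ≤ P.d) {a : ℝ} (ha : 0 < a)
    (h12 : B5.Prop12Printed (fun i => settingOf (torusRep P (levStd P i) (deltaAData (levStd_le i) a)) i)) :
    ∃ R₀ c₀ δ' : ℝ, 0 < δ' ∧ 0 ≤ c₀ ∧ ∀ (k : ℕ) (_ : k ≤ P.m + P.K) (ρ : ℕ → ℝ) (b b'' : PBond P 0),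
        R₀ ≤ kdist (P := P) k b b'' →
        |dkLocKer (P := P) ((P.eta k) ^ P.d) ((P.L : ℝ) ^ k) ρ k b b''| ≤ c₀ * Real.exp (-δ' * kdist (P := P) k b b'') :=
  decayDkLoc_torus_of_ineq722 hd levStd_le (fun j hj => ⟨j, min_eq_left hj⟩)
    (ineq722_deltaA_of_prop12Printed (levStd P) levStd_le ha (fun _ => PUnit) (fun _ _ _ => 0) (fun _ _ _ _ _ => 0)
      (fun _ _ _ => 0) h12) ha

/-! ## §5  «singularities on the diagonal»: the size of `𝒟_{k,loc}(b, b″)` for ALL `b, b″` -/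

/-- **THE SCALE-`j` TERM FOR ALL `b, b″`** (no distance condition): `|G^{(j),η}_{loc}(b, b″)| ≤ M²M_C·d²e^{a/2}K(a)²·(L^{k−j})^{d−2}` — the
scaling factor of the `L^jη`-lattice alone. [cite: BalabanImbrieJaffe1988, (2.12) p.261] -/
theorem abs_termLoc_le_unif (hd : 2 ≤ P.d) {k j : ℕ} (hj : j ≤ P.m + P.K) (hjk : j ≤ k) {a : ℝ} (ha : 0 < a)
    {δ M δC MC : ℝ} (hδ : 0 < δ) (hδC : 0 < δC) (hMC : 0 ≤ MC)
    (hH : ∀ (μ ν : Fin P.d) (x : TSite P 0) (y : TSite P j),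
      |(torusRep P j (deltaAData hj a)).H (x, μ) (y, ν)| ≤ M * Real.exp (-(δ * distEU P j x y)))
    (ρ : ℕ → ℝ)
    (hCl : ∀ b₁ b₂ : PBond P j, |Cloc P j (ρ j / 4) b₁ b₂| ≤ MC * Real.exp (-(δC * (supDist b₁.src b₂.src : ℝ))))
    (b b'' : PBond P 0) :
    |termKer (P := P) ((P.eta k) ^ P.d) ((P.L : ℝ) ^ k) ρ j b b''| ≤
      M ^ 2 * MC * ((P.d : ℝ) ^ 2 * (Real.exp (min δ δC / 2 / 2) * ((2 * (1 + P.d / (min δ δC / 2))) ^ P.d) ^ 2)) *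
        ((P.L : ℝ) ^ (k - j)) ^ (P.d - 2) := by
  have ha₀ : 0 < min δ δC / 2 := half_pos (lt_min hδ hδC)
  have hexp : Real.exp (-(min δ δC / 2 * ((supDist b.src b''.src : ℝ) / (P.L : ℝ) ^ j))) ≤ 1 := by
    rw [Real.exp_le_one_iff, neg_nonpos]
    exact mul_nonneg ha₀.le (div_nonneg (Nat.cast_nonneg _) (cast_pow_L_pos' j).le)
  refine (abs_termLoc_le hd hj hjk ha hδ hδC hMC hH ρ hCl b b'').trans ?_
  calc _ ≤ M ^ 2 * (MC * ((P.L : ℝ) ^ (k - j)) ^ (P.d - 2)) * (P.d : ℝ) ^ 2 *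
        (Real.exp (min δ δC / 2 / 2) * ((2 * (1 + P.d / (min δ δC / 2))) ^ P.d) ^ 2) * 1 :=
        mul_le_mul_of_nonneg_left hexp (by positivity)
    _ = _ := by ring

/-- **«singularities on the diagonal» AS AN UPPER BOUND** ([I] p. 326 for `𝒟_k`; here for the localized (2.12)): for ALL `η`-bonds `b, b″`,
every `k ≤ m + K` and every radius schedule, `|𝒟_{k,loc}(b, b″)| ≤ M²M_C·d²e^{a/2}K(a)²·Σ_{j<k}(L^{k−j})^{d−2}` — the sum of the scaling
factors of the `L^jη`-lattices (`≤ 2η^{−(d−2)}` for `d ≥ 3`, `= k` for `d = 2`: `sum_pow_scales_le`, `sum_pow_scales_two`).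
[cite: BalabanImbrieJaffe1988, (2.12) p.261] -/
theorem abs_dkLocKer_le_diag (hd : 2 ≤ P.d) {k : ℕ} (hk : k ≤ P.m + P.K) {a : ℝ} (ha : 0 < a) {δ M δC MC : ℝ} (hδ : 0 < δ)
    (hδC : 0 < δC) (hMC : 0 ≤ MC)
    (hH : ∀ (j : ℕ) (hj : j ≤ P.m + P.K), j < k → ∀ (μ ν : Fin P.d) (x : TSite P 0) (y : TSite P j),
      |(torusRep P j (deltaAData hj a)).H (x, μ) (y, ν)| ≤ M * Real.exp (-(δ * distEU P j x y)))
    (ρ : ℕ → ℝ)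
    (hCl : ∀ j < k, ∀ b₁ b₂ : PBond P j, |Cloc P j (ρ j / 4) b₁ b₂| ≤ MC * Real.exp (-(δC * (supDist b₁.src b₂.src : ℝ))))
    (b b'' : PBond P 0) :
    |dkLocKer (P := P) ((P.eta k) ^ P.d) ((P.L : ℝ) ^ k) ρ k b b''| ≤
      M ^ 2 * MC * ((P.d : ℝ) ^ 2 * (Real.exp (min δ δC / 2 / 2) * ((2 * (1 + P.d / (min δ δC / 2))) ^ P.d) ^ 2)) *
        ∑ j ∈ Finset.range k, ((P.L : ℝ) ^ (k - j)) ^ (P.d - 2) := by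
  rw [dkLocKer_eq_sum, Finset.mul_sum]
  refine (Finset.abs_sum_le_sum_abs _ _).trans (Finset.sum_le_sum fun j hjm => ?_)
  have hjk : j < k := Finset.mem_range.1 hjm
  have hj : j ≤ P.m + P.K := by omega
  exact abs_termLoc_le_unif hd hj hjk.le ha hδ hδC hMC (hH j hj hjk) ρ (hCl j hjk) b b''

/-- the sum of the scaling factors at `d ≥ 3`: `Σ_{j<k}(L^{k−j})^{q} ≤ 2(L^k)^{q}` for `q ≥ 1` (`L ≥ 2`; geometric: `2(L^k)^q ≤ (L^{k+1})^q`) —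
the diagonal size `O(η^{−(d−2)})` of [I] p. 326's *"singularities on the diagonal"*, `q = d − 2`. [cite: BalabanImbrieJaffe1985, (4.4.4) p.312] -/
theorem sum_pow_scales_le {q : ℕ} (hq : 1 ≤ q) (k : ℕ) :
    ∑ j ∈ Finset.range k, (((P.L : ℝ) ^ (k - j)) ^ q) ≤ 2 * ((P.L : ℝ) ^ k) ^ q := by
  have hL : (2 : ℝ) ≤ P.L := by exact_mod_cast P.hL.2
  have hL0 : (0 : ℝ) ≤ P.L := by linarith
  induction k with
  | zero => simp
  | succ k ih =>
    rw [Finset.sum_range_succ']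
    have e : ∀ i ∈ Finset.range k, ((P.L : ℝ) ^ (k + 1 - (i + 1))) ^ q = ((P.L : ℝ) ^ (k - i)) ^ q := by
      intro i _; rw [Nat.add_sub_add_right]
    rw [Finset.sum_congr rfl e, Nat.sub_zero]
    -- `2(L^k)^q ≤ (L^{k+1})^q` since `2 ≤ L ≤ L^q`
    have hLq : (2 : ℝ) ≤ (P.L : ℝ) ^ q := by
      calc (2 : ℝ) ≤ P.L := hL
        _ = (P.L : ℝ) ^ 1 := (pow_one _).symm
        _ ≤ (P.L : ℝ) ^ q := pow_le_pow_right₀ (by linarith) hq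
    have hk0 : 0 ≤ ((P.L : ℝ) ^ k) ^ q := by positivity
    have key : 2 * ((P.L : ℝ) ^ k) ^ q ≤ ((P.L : ℝ) ^ (k + 1)) ^ q := by
      rw [pow_succ, mul_pow, mul_comm]
      exact mul_le_mul_of_nonneg_left hLq hk0
    linarith

/-- … and at `d = 2` (`q = 0`) the sum of the scaling factors is the number of scales `k = log_L η⁻¹` (the logarithmic diagonal size in two
dimensions). [cite: BalabanImbrieJaffe1985, (4.4.4) p.312] -/
theorem sum_pow_scales_two (k : ℕ) : ∑ j ∈ Finset.range k, (((P.L : ℝ) ^ (k - j)) ^ 0) = k := by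
  simp

/-- **THE DIAGONAL SIZE AT `d ≥ 3`**: for all `b, b″`, `|𝒟_{k,loc}(b, b″)| ≤ 2M²M_C·d²e^{a/2}K(a)²·(L^k)^{d−2}` = `O(η^{−(d−2)})`, uniformly in the
radius schedule. [cite: BalabanImbrieJaffe1988, (2.12) p.261] -/
theorem abs_dkLocKer_le_eta (hd : 3 ≤ P.d) {k : ℕ} (hk : k ≤ P.m + P.K) {a : ℝ} (ha : 0 < a) {δ M δC MC : ℝ} (hδ : 0 < δ)
    (hδC : 0 < δC) (hMC : 0 ≤ MC)
    (hH : ∀ (j : ℕ) (hj : j ≤ P.m + P.K), j < k → ∀ (μ ν : Fin P.d) (x : TSite P 0) (y : TSite P j),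
      |(torusRep P j (deltaAData hj a)).H (x, μ) (y, ν)| ≤ M * Real.exp (-(δ * distEU P j x y)))
    (ρ : ℕ → ℝ)
    (hCl : ∀ j < k, ∀ b₁ b₂ : PBond P j, |Cloc P j (ρ j / 4) b₁ b₂| ≤ MC * Real.exp (-(δC * (supDist b₁.src b₂.src : ℝ))))
    (b b'' : PBond P 0) :
    |dkLocKer (P := P) ((P.eta k) ^ P.d) ((P.L : ℝ) ^ k) ρ k b b''| ≤
      2 * (M ^ 2 * MC * ((P.d : ℝ) ^ 2 * (Real.exp (min δ δC / 2 / 2) * ((2 * (1 + P.d / (min δ δC / 2))) ^ P.d) ^ 2))) *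
        ((P.L : ℝ) ^ k) ^ (P.d - 2) := by
  have h1 := abs_dkLocKer_le_diag (by omega) hk ha hδ hδC hMC hH ρ hCl b b''
  have h2 := sum_pow_scales_le (P := P) (q := P.d - 2) (by omega) k
  refine h1.trans ?_
  calc _ ≤ M ^ 2 * MC * ((P.d : ℝ) ^ 2 * (Real.exp (min δ δC / 2 / 2) * ((2 * (1 + P.d / (min δ δC / 2))) ^ P.d) ^ 2)) *
        (2 * ((P.L : ℝ) ^ k) ^ (P.d - 2)) := mul_le_mul_of_nonneg_left h2 (by positivity)
    _ = _ := by ring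

end

end Literature.MathematicalPhysics.QuantumFieldTheory.BalabanImbrieJaffe1984to88.BIJ88CurlyDkLocDecayTorus
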